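import Literature.NumberTheory.LFunctions.VinogradovKorobovIntermediateAssembly
import Literature.NumberTheory.LFunctions.VinogradovKorobovFarZeros
import HarnessLib

/-!
# Lemma 6.1 and Theorem 1.4 of Mossinghoff–Trudgian–Yang from the smoothed zero detector, Patel's bound and (3.8)

Topic `Literature/NumberTheory/LFunctions`. The closing corollaries of the decomposition of the
named facts `Literature.NumberTheory.LFunctions.zero_inequality_intermediate_mossinghoff_trudgian_yang`
(**Lemma 6.1**) and `Literature.NumberTheory.LFunctions.zero_free_region_intermediate_mossinghoff_trudgian_yang`
(**Theorem 1.4**, threshold `exp 1000`) of Mossinghoff–Trudgian–Yang, *Res. Number Theory* 10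
(2024) = arXiv:2212.06867 (arXiv numbering). Everything here is PROVED; no named fact is
introduced.

`VinogradovKorobovIntermediateAssembly.lean` proves both named facts from three inputs: `h42`
(MTY **Lemma 4.2** = Ford's Lemmas 4.5–4.6, the smoothed zero detector at `η = ½` in the raw form
`FordDetectorIneqRaw`, with the far-zero sum over the strict complement `|1 + it − ρ| > ½` of the
near disc, `FordFarZeroSumLT`), Patel's sub-Weyl bound (3.3) (the named fact
`zeta_half_line_patel`) and `h92` = the far-zero bound **(6.4)** from `exp 999` on;
`VinogradovKorobovFarZeros.lean` proves (6.4) for `t ≥ e²⁴⁰` from the Riemann–von Mangoldt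
formula **(3.8)** (the named fact `zetaZeroCount_hasanalizade_shen_wong`). Hence:

* `zero_inequality_intermediate_mossinghoff_trudgian_yang_of_detector` — **Lemma 6.1 from `h42`,
  Patel's fact and (3.8)**;
* `zero_free_region_intermediate_mossinghoff_trudgian_yang_of_detector` — **Theorem 1.4 as printed
  from `h42`, Patel's fact and (3.8)**.

What remains of the printed proof of Theorem 1.4 that is not a theorem of the tree is therefore
exactly: MTY Lemma 4.2 (Ford's Lemma 4.5: the mollified explicit formula for `K_f(s)` with the
contour shift to `Re w = −½`, Lemma 3.2, `Σ|ρ|^{-2} ≤ 0.0463`; and Lemma 2.2, the zero detector via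
the Hadamard product, as in Lemma 4.6), Patel's (3.3) and Hasanalizade–Shen–Wong's (3.8) — the last
two being named facts of the tree with their own discharge units.

## References

* M. J. Mossinghoff, T. S. Trudgian, A. Yang, *Explicit zero-free regions for the Riemann
  zeta-function*, Res. Number Theory 10 (2024), no. 11 = arXiv:2212.06867: Lemma 4.2, (3.3),
  (3.8), Lemma 6.1, Theorem 1.4 (`MossinghoffTrudgianYangRNT2024`).
* K. Ford, *Zero-free regions for the Riemann zeta function*, Number Theory for the Millennium II
  (Urbana, IL, 2000), A K Peters 2002, 25–56 = arXiv:1910.08205: Lemmas 4.5–4.6, (9.2)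
  (`Ford2002Millennium`).
-/

noncomputable section

open Complex Real

namespace Literature.NumberTheory.LFunctions

/-- **Lemma 6.1 of Mossinghoff–Trudgian–Yang (the named fact) from MTY Lemma 4.2 at `η = ½`,
Patel's (3.3) and the Riemann–von Mangoldt formula (3.8).**
[cite: MossinghoffTrudgianYangRNT2024, Lemma 6.1] -/
theorem zero_inequality_intermediate_mossinghoff_trudgian_yang_of_detector
    (h42 : ∀ (f : ℝ → ℝ) (D : ℝ), IsFordSmoothing f (1 / 2) D →
      (∀ t : ℝ, 1000 ≤ t → ∀ S : ℝ, FordFarZeroSumLT t (1 / 2) S →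
        FordDetectorIneqRaw (1 / 2) f D t S) ∧
        (fordK f 1).re ≤ (fordLaplace f 0).re + 1.8 * D)
    (hP : zeta_half_line_patel) (hN : zetaZeroCount_hasanalizade_shen_wong) :
    zero_inequality_intermediate_mossinghoff_trudgian_yang :=
  zero_inequality_intermediate_mossinghoff_trudgian_yang_of_ford FordFarZeroSumLT h42 hP
    fun t ht T hT ↦ farZeroSum_half_strict_of_hsw_exp999 hN t ht T hT

/-- **Theorem 1.4 of Mossinghoff–Trudgian–Yang as printed (the named fact, threshold `exp 1000`)
from MTY Lemma 4.2 at `η = ½`, Patel's (3.3) and the Riemann–von Mangoldt formula (3.8).**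
[cite: MossinghoffTrudgianYangRNT2024, Theorem 1.4] -/
theorem zero_free_region_intermediate_mossinghoff_trudgian_yang_of_detector
    (h42 : ∀ (f : ℝ → ℝ) (D : ℝ), IsFordSmoothing f (1 / 2) D →
      (∀ t : ℝ, 1000 ≤ t → ∀ S : ℝ, FordFarZeroSumLT t (1 / 2) S →
        FordDetectorIneqRaw (1 / 2) f D t S) ∧
        (fordK f 1).re ≤ (fordLaplace f 0).re + 1.8 * D)
    (hP : zeta_half_line_patel) (hN : zetaZeroCount_hasanalizade_shen_wong) :
    zero_free_region_intermediate_mossinghoff_trudgian_yang :=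
  zero_free_region_intermediate_mossinghoff_trudgian_yang_of_ford FordFarZeroSumLT h42 hP
    fun t ht T hT ↦ farZeroSum_half_strict_of_hsw_exp999 hN t ht T hT

end Literature.NumberTheory.LFunctions
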